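import Mathlib
import Summits.NavierStokesRegularity.NavierStokesRegularity.Theorems.L3TimeExponentPincerRingDatumProfile
import HarnessLib.Audit
import HarnessLib

/-!
# L3TimeExponentPincer — ring datum calculus XI: the potential `F = ∫_R^s τ^{-5/2} G`

Support kernel for the crux `L3CascadeJaw` (item stmt-NavierStokesRegularity-19499): collects,
for the concrete potential `F(s) = ∫_R^s τ^{-5/2} G(τ) dτ` built from a shape function `G ∈ C^∞`
with `G = 0` on `(−∞, a]` (`0 < a ≤ R`) and on `[R, ∞)`, `|G| ≤ K`, `G ≤ 0`, exactly the
`F`-level hypotheses consumed by `ringField_frame` (`F = 0` on `[R,∞)`), `angVortQuot_ringField_eq`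
(`F' = s^{-5/2}G`), and `norm_ringField_sq_le_max` (the four profile bounds):

* `contDiff_potential`, `deriv_potential`, `potential_eq_zero_of_ge`;
* `abs_deriv_potential_le`, `deriv_potential_eq_zero_of_lt`;
* `abs_potential_le_of_ge`, `abs_potential_le_of_le` — the two size bounds;
* `potential_nonneg`.

WHAT THIS IS NOT: one-variable calculus plumbing.
-/

namespace Summit.NavierStokesRegularity.NavierStokesRegularity.Theorems.L3TimeExponentPincerRingDatumPotential

open Real Set MeasureTheory intervalIntegral
open Summit.NavierStokesRegularity.NavierStokesRegularity.Theorems.L3TimeExponentPincerRingDatumProfile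
open scoped ContDiff Topology

variable {G : ℝ → ℝ} {a R K : ℝ}

/-- The integrand `τ^{-5/2} G` is continuous when `G ∈ C^∞` vanishes below `a > 0`. -/
theorem continuous_rpowProfile (hG : ContDiff ℝ ∞ G) (ha : 0 < a) (hGa : ∀ s, s ≤ a → G s = 0) :
    Continuous fun s : ℝ => s ^ (-(5 / 2 : ℝ)) * G s :=
  (contDiff_rpowProfile hG ha hGa).continuous

/-- **`F ∈ C^∞`**. -/
theorem contDiff_potential (hG : ContDiff ℝ ∞ G) (ha : 0 < a) (hGa : ∀ s, s ≤ a → G s = 0) :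
    ContDiff ℝ ∞ (fun s : ℝ => ∫ τ in R..s, τ ^ (-(5 / 2 : ℝ)) * G τ) :=
  contDiff_primitive (contDiff_rpowProfile hG ha hGa) R

/-- **`F' = s^{-5/2} G`**. -/
theorem deriv_potential (hG : ContDiff ℝ ∞ G) (ha : 0 < a) (hGa : ∀ s, s ≤ a → G s = 0) :
    deriv (fun s : ℝ => ∫ τ in R..s, τ ^ (-(5 / 2 : ℝ)) * G τ) =
      fun s : ℝ => s ^ (-(5 / 2 : ℝ)) * G s :=
  deriv_primitive (continuous_rpowProfile hG ha hGa) R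

/-- **`F = 0` on `[R, ∞)`** when `G = 0` there. -/
theorem potential_eq_zero_of_ge (hGR : ∀ s, R ≤ s → G s = 0) {s : ℝ} (hs : R ≤ s) :
    (∫ τ in R..s, τ ^ (-(5 / 2 : ℝ)) * G τ) = 0 :=
  primitive_eq_zero_of_ge (f := fun τ : ℝ => τ ^ (-(5 / 2 : ℝ)) * G τ)
    (fun τ hτ => by simp only [hGR τ hτ, mul_zero]) hs

/-- **`|F'(s)| ≤ K s^{-5/2}`** for `0 ≤ s` when `|G| ≤ K`. -/
theorem abs_deriv_potential_le (hG : ContDiff ℝ ∞ G) (ha : 0 < a) (hGa : ∀ s, s ≤ a → G s = 0)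
    (hK : ∀ τ, |G τ| ≤ K) {s : ℝ} (hs : 0 ≤ s) :
    |deriv (fun s : ℝ => ∫ τ in R..s, τ ^ (-(5 / 2 : ℝ)) * G τ) s| ≤ K * s ^ (-(5 / 2 : ℝ)) := by
  rw [deriv_potential hG ha hGa]
  beta_reduce
  rw [abs_mul, abs_of_nonneg (Real.rpow_nonneg hs _), mul_comm]
  exact mul_le_mul_of_nonneg_right (hK s) (Real.rpow_nonneg hs _)

/-- **`F'(s) = 0` for `s < a`** (indeed for `s ≤ a`). -/
theorem deriv_potential_eq_zero_of_le (hG : ContDiff ℝ ∞ G) (ha : 0 < a)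
    (hGa : ∀ s, s ≤ a → G s = 0) {s : ℝ} (hs : s ≤ a) :
    deriv (fun s : ℝ => ∫ τ in R..s, τ ^ (-(5 / 2 : ℝ)) * G τ) s = 0 := by
  rw [deriv_potential hG ha hGa]
  exact rpowProfile_eq_zero hGa hs

/-- **`|F(s)| ≤ (2K/3) s^{-3/2}` for `a ≤ s`** (`0 < a ≤ R`, `|G| ≤ K`, `G = 0` on `[R, ∞)`). -/
theorem abs_potential_le_of_ge (ha : 0 < a) (hK : ∀ τ, |G τ| ≤ K)
    (hGR : ∀ s, R ≤ s → G s = 0) {s : ℝ} (hs : a ≤ s) :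
    |∫ τ in R..s, τ ^ (-(5 / 2 : ℝ)) * G τ| ≤ (2 * K / 3) * s ^ (-(3 / 2 : ℝ)) := by
  have hs0 : 0 < s := ha.trans_le hs
  rcases le_or_gt s R with hsR | hsR
  · exact abs_primitive_le hK hs0 hsR
  · rw [potential_eq_zero_of_ge hGR hsR.le, abs_zero]
    have hK0 : 0 ≤ K := (abs_nonneg _).trans (hK 0)
    exact mul_nonneg (by positivity) (Real.rpow_nonneg hs0.le _)

/-- **`|F(s)| ≤ (2K/3) a^{-3/2}` for `s ≤ a`** (`F` is constant below `a`). -/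
theorem abs_potential_le_of_le (hG : ContDiff ℝ ∞ G) (ha : 0 < a) (hGa : ∀ s, s ≤ a → G s = 0)
    (hK : ∀ τ, |G τ| ≤ K) (hGR : ∀ s, R ≤ s → G s = 0) {s : ℝ} (hs : s ≤ a) :
    |∫ τ in R..s, τ ^ (-(5 / 2 : ℝ)) * G τ| ≤ (2 * K / 3) * a ^ (-(3 / 2 : ℝ)) := by
  rw [primitive_eq_of_le (continuous_rpowProfile hG ha hGa)
    (fun τ hτ => rpowProfile_eq_zero hGa hτ) hs]
  exact abs_potential_le_of_ge ha hK hGR le_rfl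

/-- **`F ≥ 0`** everywhere (`G ≤ 0`, `0 < a ≤ R`). -/
theorem potential_nonneg (hG : ContDiff ℝ ∞ G) (ha : 0 < a) (haR : a ≤ R)
    (hGa : ∀ s, s ≤ a → G s = 0) (hG0 : ∀ τ, G τ ≤ 0) (hGR : ∀ s, R ≤ s → G s = 0) (s : ℝ) :
    0 ≤ ∫ τ in R..s, τ ^ (-(5 / 2 : ℝ)) * G τ := by
  rcases le_or_gt s a with hs | hs
  · rw [primitive_eq_of_le (continuous_rpowProfile hG ha hGa)
      (fun τ hτ => rpowProfile_eq_zero hGa hτ) hs]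
    exact primitive_nonneg hG0 ha haR
  · rcases le_or_gt s R with hsR | hsR
    · exact primitive_nonneg hG0 (ha.trans hs) hsR
    · rw [potential_eq_zero_of_ge hGR hsR.le]

end Summit.NavierStokesRegularity.NavierStokesRegularity.Theorems.L3TimeExponentPincerRingDatumPotential
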